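import Mathlib
import Summits.ValiantsHypothesis.ValiantsHypothesis.Theorems.RigidityForcesSymmetryRankRigidMinimalReprLaplaceFiveSeparatedCaptureCommonLinePencils

/-!
# ValiantsHypothesis / RigidityForcesSymmetry — crux `LaplaceOptimalFive` (stmt-ValiantsHypothesis-24813), symmetric capture:
# ★★ **THE PENCIL-PLUS-PLANE BOUND THROUGH A COMMON LINE** `finrank W ≤ κ(u) + finrank prolong(U₀₁ ⊔ U₀₂) + finrank prolong(U₁₂)`
# (`U₀₁ = span {u, a}`, `u ∈ U₀₂ ∩ U₁₂`, `a ∉ U₀₂`) — the sharpening of ✓ `finrank_le_symDiag_add_two_prolong`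

Brick 3 (part 5) of the `(2,2,2)♭` residue of the K1 lane (val-port-2 g6, 2026-08-29).  Same representation and the same two projections
as ✓ `…SeparatedCaptureCommonLinePencils` (`T_μ = Sym(u⊗s) + Sym(a⊗t) − G¹ − G²`, project to `G¹`, then to `G²`, then to `s`); the
only new remark: once `G¹ = 0` the linkage kills `t`, and then the second linkage `s_y u − G²_y ∈ U₁₂` together with `u ∈ U₁₂` puts EVERY
slice of `G²` in the plane `U₁₂` itself — so the middle term is `finrank prolong U₁₂` (≤ 2 for a plane, 0 for most planes) instead of
`finrank prolong(U₀₁ ⊔ U₁₂)`.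

* ★★ `finrank_le_symDiag_add_prolong_add_plane` — master count with an abstract bound `m` on the square-freeness space `K(u)`.
* ★ `finrank_le_three_add_prolong_add_plane` (`u ≠ 0`), ★ `finrank_le_prolong_add_plane_of_diag_ne_zero` (`u` with a nonzero diagonal entry).
  Census of record (NOTE-port2g6-24813-common-line-residue.md rev 4, `clres3.py`): with ✓PG/✓CLB/✓CLP/LetterFlat this count closes the
  flat pair-monomial families (`pX = 2`, the cap-4/5 witnesses of rev 2) and leaves, among 900 structured common-line samples, 18 open —
  all of the shape «two of the three planes binary in ⟨x_a, x_b⟩ (prolongation 2 each)».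

Honest framing.  A count; that residue, every profile with a span of `finrank ≥ 3` outside the landed cells, `CaptureIneqSym` in general,
K1 on `K₃ ⊔ K₂`, `LaplaceOptimalFive` (OPEN · CONTESTED 72/120), `RankRigidMinimalRepr` and `VP ≠ VNP` are NOT proved here.
No definitions, no `sorry`.
-/

set_option linter.dupNamespace false
set_option autoImplicit false

namespace Summit.ValiantsHypothesis.ValiantsHypothesis.Theorems.RigidityForcesSymmetryRankRigidMinimalRepr

namespace LaplaceFiveSeparatedCapture

open Finset

/-- ★★ **PENCIL-PLUS-PLANE BOUND THROUGH A COMMON LINE (master form).**  `U₀₁ = span {u, a}` with `u, a` symmetric, `u ∈ U₀₂ ∩ U₁₂`,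
`a ∉ U₀₂`; `U₀₂`, `U₁₂` symmetric.  If every space `S` of vectors `s` with `Sym(u ⊗ s)` square-free has `finrank S ≤ m`, then every `W`
of symmetric zero-diagonal leaf matrices captured by `L3 U₀₁ U₀₂ U₁₂` has
`finrank W ≤ m + finrank prolong(U₀₁ ⊔ U₀₂) + finrank prolong U₁₂`. [folklore] -/
theorem finrank_le_symDiag_add_prolong_add_plane (u a : Fin 5 → Fin 5 → ℂ) (hu : ∀ p q, u p q = u q p) (ha : ∀ p q, a p q = a q p)
    (U02 U12 W : Submodule ℂ (Fin 5 → Fin 5 → ℂ))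
    (h02s : ∀ x ∈ U02, ∀ p q : Fin 5, x p q = x q p) (h12s : ∀ x ∈ U12, ∀ p q : Fin 5, x p q = x q p)
    (huU : u ∈ U02) (huU' : u ∈ U12) (haU : a ∉ U02) (m : ℕ)
    (hm : ∀ S : Submodule ℂ (Fin 5 → ℂ), (∀ s ∈ S, ∀ p r : Fin 5, s p * u p r + s p * u p r + s r * u p p = 0) →
      Module.finrank ℂ S ≤ m)
    (hWs : ∀ μ ∈ W, ∀ s t : Fin 5, μ s t = μ t s) (hWd : ∀ μ ∈ W, ∀ s : Fin 5, μ s s = 0)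
    (hWc : ∀ μ ∈ W, contractZ μ ∈ L3 (Submodule.span ℂ ({u, a} : Set (Fin 5 → Fin 5 → ℂ))) U02 U12) :
    Module.finrank ℂ W ≤ m + Module.finrank ℂ (prolong (Submodule.span ℂ ({u, a} : Set (Fin 5 → Fin 5 → ℂ)) ⊔ U02))
      + Module.finrank ℂ (prolong U12) := by
  classical
  set P : Submodule ℂ (Fin 5 → Fin 5 → ℂ) := Submodule.span ℂ ({u, a} : Set (Fin 5 → Fin 5 → ℂ)) with hPdef
  have huP : u ∈ P := Submodule.subset_span (by simp)
  have haP : a ∈ P := Submodule.subset_span (by simp)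
  have hPs : ∀ x ∈ P, ∀ p q : Fin 5, x p q = x q p := by
    intro x hx p q
    obtain ⟨c, d, rfl⟩ := Submodule.mem_span_pair.mp hx
    simp only [Pi.add_apply, Pi.smul_apply, smul_eq_mul, hu p q, ha p q]
  -- placements
  let symU : (Fin 5 → ℂ) →ₗ[ℂ] (Fin 5 → Fin 5 → Fin 5 → ℂ) :=
    { toFun := fun z p q r => z p * u q r + z q * u p r + z r * u p q
      map_add' := fun z y => by funext p q r; simp only [Pi.add_apply]; ring
      map_smul' := fun c z => by funext p q r; simp only [Pi.smul_apply, smul_eq_mul, RingHom.id_apply]; ring }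
  let symA : (Fin 5 → ℂ) →ₗ[ℂ] (Fin 5 → Fin 5 → Fin 5 → ℂ) :=
    { toFun := fun z p q r => z p * a q r + z q * a p r + z r * a p q
      map_add' := fun z y => by funext p q r; simp only [Pi.add_apply]; ring
      map_smul' := fun c z => by funext p q r; simp only [Pi.smul_apply, smul_eq_mul, RingHom.id_apply]; ring }
  let tensUA : ((Fin 5 → ℂ) × (Fin 5 → ℂ)) →ₗ[ℂ] (Fin 5 → Fin 5 → Fin 5 → ℂ) :=
    { toFun := fun z x q r => z.1 x * u q r + z.2 x * a q r
      map_add' := fun z y => by funext x q r; simp only [Prod.fst_add, Prod.snd_add, Pi.add_apply]; ring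
      map_smul' := fun c z => by
        funext x q r; simp only [Prod.smul_fst, Prod.smul_snd, Pi.smul_apply, smul_eq_mul, RingHom.id_apply]; ring }
  -- representation space `(s, t, G¹, G²)`
  let Xsp := ((Fin 5 → ℂ) × (Fin 5 → ℂ)) × ((Fin 5 → Fin 5 → Fin 5 → ℂ) × (Fin 5 → Fin 5 → Fin 5 → ℂ))
  let πst : Xsp →ₗ[ℂ] ((Fin 5 → ℂ) × (Fin 5 → ℂ)) := LinearMap.fst ℂ _ _
  let πs : Xsp →ₗ[ℂ] (Fin 5 → ℂ) := (LinearMap.fst ℂ _ _).comp πst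
  let πt : Xsp →ₗ[ℂ] (Fin 5 → ℂ) := (LinearMap.snd ℂ _ _).comp πst
  let πG1 : Xsp →ₗ[ℂ] (Fin 5 → Fin 5 → Fin 5 → ℂ) := (LinearMap.fst ℂ _ _).comp (LinearMap.snd ℂ _ _)
  let πG2 : Xsp →ₗ[ℂ] (Fin 5 → Fin 5 → Fin 5 → ℂ) := (LinearMap.snd ℂ _ _).comp (LinearMap.snd ℂ _ _)
  let Φ : Xsp →ₗ[ℂ] (Fin 5 → Fin 5 → Fin 5 → ℂ) := symU.comp πs + symA.comp πt - πG1 - πG2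
  let lamB : Xsp →ₗ[ℂ] (Fin 5 → Fin 5 → Fin 5 → ℂ) := tensUA.comp πst - πG1
  let lamC : Xsp →ₗ[ℂ] (Fin 5 → Fin 5 → Fin 5 → ℂ) := tensUA.comp πst - πG2
  have hΦ : ∀ x : Xsp, ∀ p q r, Φ x p q r = (x.1.1 p * u q r + x.1.1 q * u p r + x.1.1 r * u p q)
      + (x.1.2 p * a q r + x.1.2 q * a p r + x.1.2 r * a p q) - x.2.1 p q r - x.2.2 p q r := fun x p q r => rfl
  have hlamB : ∀ x : Xsp, ∀ y q r, lamB x y q r = x.1.1 y * u q r + x.1.2 y * a q r - x.2.1 y q r := fun x y q r => rfl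
  have hlamC : ∀ x : Xsp, ∀ y q r, lamC x y q r = x.1.1 y * u q r + x.1.2 y * a q r - x.2.2 y q r := fun x y q r => rfl
  have hπs : ∀ x : Xsp, πs x = x.1.1 := fun x => rfl
  have hπG1 : ∀ x : Xsp, πG1 x = x.2.1 := fun x => rfl
  have hπG2 : ∀ x : Xsp, πG2 x = x.2.2 := fun x => rfl
  let U02pi : Submodule ℂ (Fin 5 → Fin 5 → Fin 5 → ℂ) := Submodule.pi Set.univ (fun _ : Fin 5 => U02)
  let U12pi : Submodule ℂ (Fin 5 → Fin 5 → Fin 5 → ℂ) := Submodule.pi Set.univ (fun _ : Fin 5 => U12)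
  let R : Submodule ℂ Xsp := (W.map cZ).comap Φ ⊓ ((prolong (P ⊔ U02)).comap πG1 ⊓ ((prolong (P ⊔ U12)).comap πG2 ⊓
    (U02pi.comap lamB ⊓ U12pi.comap lamC)))
  -- every obligation lies in `Φ(R)`
  have hmem : ∀ μ ∈ W, contractZ μ ∈ R.map Φ := by
    intro μ hμ
    obtain ⟨A, B, C, hA, hB, hC, hT⟩ := L3_finite_form P U02 U12 (hWc μ hμ)
    have hAc : ∀ y, ∃ c d : ℂ, c • u + d • a = A y := fun y => Submodule.mem_span_pair.mp (hA y)
    choose s t hst using hAc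
    have hA' : ∀ y p q, A y p q = s y * u p q + t y * a p q := fun y p q => by
      rw [← hst y]; simp only [Pi.add_apply, Pi.smul_apply, smul_eq_mul]
    have hAs : ∀ y p q, A y p q = A y q p := fun y => hPs _ (hA y)
    let G1 : Fin 5 → Fin 5 → Fin 5 → ℂ := fun x y z => A x y z - B x y z
    let G2 : Fin 5 → Fin 5 → Fin 5 → ℂ := fun x y z => A x y z - C x y z
    have hG1d : ∀ x y z, G1 x y z = A x y z - B x y z := fun _ _ _ => rfl
    have hG2d : ∀ x y z, G2 x y z = A x y z - C x y z := fun _ _ _ => rfl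
    have h1_23 : ∀ x y z, G1 x y z = G1 x z y := fun x y z => by rw [hG1d, hG1d, hAs x y z, h02s _ (hB x) y z]
    have h2_23 : ∀ x y z, G2 x y z = G2 x z y := fun x y z => by rw [hG2d, hG2d, hAs x y z, h12s _ (hC x) y z]
    have h1_13 : ∀ x y z, G1 x y z = G1 z y x := fun x y z => by
      have h := contractZ_swap23 μ y x z
      rw [hT, hT] at h
      have hc := h12s _ (hC y) z x
      rw [hG1d, hG1d]
      linear_combination h - hc
    have h2_13 : ∀ x y z, G2 x y z = G2 z y x := fun x y z => by
      have h : contractZ μ z y x = contractZ μ x y z := by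
        rw [contractZ_swap12 μ y z x, contractZ_swap23 μ y x z, contractZ_swap12 μ x y z]
      rw [hT, hT, hAs x z y, hAs z x y] at h
      have hb := h02s _ (hB y) z x
      rw [hG2d, hG2d]
      linear_combination h - hb
    have h1_12 : ∀ x y z, G1 x y z = G1 y x z := fun x y z => by rw [h1_23 y x z, h1_13 y z x, h1_23 x z y]
    have h2_12 : ∀ x y z, G2 x y z = G2 y x z := fun x y z => by rw [h2_23 y x z, h2_13 y z x, h2_23 x z y]
    have hAx : ∀ x, A x = s x • u + t x • a := fun x => by
      funext p q; rw [hA']; simp only [Pi.add_apply, Pi.smul_apply, smul_eq_mul]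
    have hG1p : G1 ∈ prolong (P ⊔ U02) := by
      refine (mem_prolong_iff _ G1).mpr ⟨h1_12, h1_23, fun x => ?_⟩
      have e : G1 x = A x - B x := by funext y z; rw [hG1d, Pi.sub_apply, Pi.sub_apply]
      rw [e]
      exact Submodule.sub_mem _ (Submodule.mem_sup_left (hA x)) (Submodule.mem_sup_right (hB x))
    have hG2p : G2 ∈ prolong (P ⊔ U12) := by
      refine (mem_prolong_iff _ G2).mpr ⟨h2_12, h2_23, fun x => ?_⟩
      have e : G2 x = A x - C x := by funext y z; rw [hG2d, Pi.sub_apply, Pi.sub_apply]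
      rw [e]
      exact Submodule.sub_mem _ (Submodule.mem_sup_left (hA x)) (Submodule.mem_sup_right (hC x))
    have hrep : Φ ((s, t), (G1, G2)) = contractZ μ := by
      funext p q r
      rw [hΦ, hT p q r]
      show (s p * u q r + s q * u p r + s r * u p q) + (t p * a q r + t q * a p r + t r * a p q) - G1 p q r - G2 p q r
        = A r p q + B q p r + C p q r
      rw [h1_12 p q r, hG1d, hG2d, hA' r p q, hA' q p r, hA' p q r]
      ring
    refine Submodule.mem_map.mpr ⟨((s, t), (G1, G2)), ?_, hrep⟩
    refine Submodule.mem_inf.mpr ⟨?_, Submodule.mem_inf.mpr ⟨?_, Submodule.mem_inf.mpr ⟨?_, Submodule.mem_inf.mpr ⟨?_, ?_⟩⟩⟩⟩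
    · rw [Submodule.mem_comap, hrep]
      exact Submodule.mem_map.mpr ⟨μ, hμ, cZ_apply μ⟩
    · rw [Submodule.mem_comap]; exact hG1p
    · rw [Submodule.mem_comap]; exact hG2p
    · rw [Submodule.mem_comap, Submodule.mem_pi]
      intro y _
      have e : lamB ((s, t), (G1, G2)) y = B y := by
        funext q r
        rw [hlamB]
        show s y * u q r + t y * a q r - G1 y q r = B y q r
        rw [hG1d, hA']; ring
      rw [e]; exact hB y
    · rw [Submodule.mem_comap, Submodule.mem_pi]
      intro y _
      have e : lamC ((s, t), (G1, G2)) y = C y := by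
        funext q r
        rw [hlamC]
        show s y * u q r + t y * a q r - G2 y q r = C y q r
        rw [hG2d, hA']; ring
      rw [e]; exact hC y
  -- linkage: `G¹ = 0` forces `t = 0` (because `u ∈ U₀₂` and `a ∉ U₀₂`)
  have ht0 : ∀ x ∈ R, πG1 x = 0 → x.1.2 = 0 := by
    intro x hx hG10
    obtain ⟨-, hx2⟩ := Submodule.mem_inf.mp hx
    obtain ⟨-, hx3⟩ := Submodule.mem_inf.mp hx2
    obtain ⟨-, hx4⟩ := Submodule.mem_inf.mp hx3
    obtain ⟨hxB, -⟩ := Submodule.mem_inf.mp hx4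
    rw [Submodule.mem_comap, Submodule.mem_pi] at hxB
    rw [hπG1] at hG10
    funext y
    by_contra hty
    have hy := hxB y (Set.mem_univ y)
    have e : lamB x y = x.1.1 y • u + x.1.2 y • a := by
      funext q r
      show x.1.1 y * u q r + x.1.2 y * a q r - x.2.1 y q r = (x.1.1 y • u + x.1.2 y • a) q r
      rw [hG10]
      simp
    rw [e] at hy
    have hta : x.1.2 y • a ∈ U02 := by
      have h2 := U02.sub_mem hy (U02.smul_mem (x.1.1 y) huU)
      rwa [add_sub_cancel_left] at h2
    have : a ∈ U02 := by
      have h2 := U02.smul_mem (x.1.2 y)⁻¹ hta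
      rwa [smul_smul, inv_mul_cancel₀ hty, one_smul] at h2
    exact haU this
  -- first projection: `π = G¹`, `ρ = (s, G²)`
  let ρ1 : Xsp →ₗ[ℂ] ((Fin 5 → ℂ) × (Fin 5 → Fin 5 → Fin 5 → ℂ)) := LinearMap.prod πs πG2
  have hρ1 : ∀ x ∈ R, πG1 x = 0 → ρ1 x = 0 → x = 0 := by
    intro x hx hG10 hρ0
    have hs0 : πs x = 0 := congrArg Prod.fst hρ0
    have hG20 : πG2 x = 0 := congrArg Prod.snd hρ0
    have ht := ht0 x hx hG10
    rw [hπG1] at hG10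
    rw [hπG2] at hG20
    rw [hπs] at hs0
    exact Prod.ext (Prod.ext hs0 ht) (Prod.ext hG10 hG20)
  have hstep1 := finrank_map_le_add Φ πG1 ρ1 R hρ1
  -- second projection on `R' = R ⊓ ker G¹`: `π = G²`, `ρ = s`
  let R' : Submodule ℂ Xsp := R ⊓ LinearMap.ker πG1
  have hρ2 : ∀ x ∈ R', πG2 x = 0 → πs x = 0 → x = 0 := by
    intro x hx hG20 hs0
    obtain ⟨hxR, hxk⟩ := Submodule.mem_inf.mp hx
    have hG10 : πG1 x = 0 := LinearMap.mem_ker.mp hxk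
    have ht := ht0 x hxR hG10
    rw [hπG1] at hG10
    rw [hπG2] at hG20
    rw [hπs] at hs0
    exact Prod.ext (Prod.ext hs0 ht) (Prod.ext hG10 hG20)
  have hstep2 := finrank_map_le_add ρ1 πG2 πs R' hρ2
  -- the last kernel: `G¹ = G² = 0`, `t = 0`, the obligation is `Sym(u ⊗ s)`, square-free ⇒ `s ∈ K(u)`
  have hS : ∀ s ∈ (R' ⊓ LinearMap.ker πG2).map πs, ∀ p r : Fin 5, s p * u p r + s p * u p r + s r * u p p = 0 := by
    intro s hs p r
    obtain ⟨x, hx, rfl⟩ := Submodule.mem_map.mp hs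
    obtain ⟨hxR', hxk2⟩ := Submodule.mem_inf.mp hx
    obtain ⟨hxR, hxk1⟩ := Submodule.mem_inf.mp hxR'
    have hG10 : πG1 x = 0 := LinearMap.mem_ker.mp hxk1
    have hG20 : πG2 x = 0 := LinearMap.mem_ker.mp hxk2
    have ht := ht0 x hxR hG10
    rw [hπG1] at hG10
    rw [hπG2] at hG20
    obtain ⟨hxW, -⟩ := Submodule.mem_inf.mp hxR
    rw [Submodule.mem_comap] at hxW
    obtain ⟨μ, -, hμ⟩ := Submodule.mem_map.mp hxW
    have e := congrFun (congrFun (congrFun hμ p) p) r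
    rw [cZ_apply, contractZ_rep12, hΦ, ht, hG10, hG20] at e
    rw [hπs]
    simp only [Pi.zero_apply, zero_mul, add_zero, sub_zero] at e
    linear_combination -e
  have hm' := hm _ hS
  -- bounds of the images
  have h1 : Module.finrank ℂ (R.map πG1) ≤ Module.finrank ℂ (prolong (P ⊔ U02)) := by
    refine Submodule.finrank_mono ?_
    rw [Submodule.map_le_iff_le_comap]
    exact inf_le_right.trans inf_le_left
  have h2 : Module.finrank ℂ (R'.map πG2) ≤ Module.finrank ℂ (prolong U12) := by
    refine Submodule.finrank_mono ?_
    intro G hG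
    obtain ⟨x, hx, rfl⟩ := Submodule.mem_map.mp hG
    obtain ⟨hxR, hxk⟩ := Submodule.mem_inf.mp hx
    have hG10 : πG1 x = 0 := LinearMap.mem_ker.mp hxk
    have ht := ht0 x hxR hG10
    obtain ⟨-, hx2⟩ := Submodule.mem_inf.mp hxR
    obtain ⟨-, hx3⟩ := Submodule.mem_inf.mp hx2
    obtain ⟨hxP, hx4⟩ := Submodule.mem_inf.mp hx3
    obtain ⟨-, hxC⟩ := Submodule.mem_inf.mp hx4
    rw [Submodule.mem_comap, mem_prolong_iff] at hxP
    rw [Submodule.mem_comap, Submodule.mem_pi] at hxC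
    rw [hπG2, mem_prolong_iff]
    refine ⟨hxP.1, hxP.2.1, fun y => ?_⟩
    have hy := hxC y (Set.mem_univ y)
    have e : x.2.2 y = x.1.1 y • u - lamC x y := by
      funext q r
      show x.2.2 y q r = (x.1.1 y • u - lamC x y) q r
      rw [Pi.sub_apply, Pi.sub_apply, hlamC, ht]
      simp
    rw [e]
    exact U12.sub_mem (U12.smul_mem _ huU') hy
  -- `W ↪ Φ(R)`
  let f : W →ₗ[ℂ] (R.map Φ) := LinearMap.codRestrict (R.map Φ) (cZ.domRestrict W) (fun μ => by
    simpa [cZ_apply] using hmem μ.1 μ.2)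
  have hf : Function.Injective f := by
    rw [injective_iff_map_eq_zero]
    intro μ hμ
    have hT : contractZ μ.1 = 0 := by
      have := congrArg Subtype.val hμ
      simpa [f, cZ_apply] using this
    apply Subtype.ext
    refine hub_injective μ.1 (hWs μ.1 μ.2) (hWd μ.1 μ.2) fun p q => ?_
    simp [hT]
  have hW_le := LinearMap.finrank_le_finrank_of_injective hf
  have e1 : (R ⊓ LinearMap.ker πG1).map ρ1 = R'.map ρ1 := rfl
  rw [e1] at hstep1
  omega

/-- ★ **`finrank W ≤ 3 + finrank prolong(U₀₁ ⊔ U₀₂) + finrank prolong U₁₂`** for `U₀₁ = span {u, a}`, `u ≠ 0`, `u ∈ U₀₂ ∩ U₁₂`,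
`a ∉ U₀₂` (✓ `finrank_symDiag_le_three`). [folklore] -/
theorem finrank_le_three_add_prolong_add_plane (u a : Fin 5 → Fin 5 → ℂ) (hu : ∀ p q, u p q = u q p) (ha : ∀ p q, a p q = a q p)
    (hu0 : u ≠ 0) (U02 U12 W : Submodule ℂ (Fin 5 → Fin 5 → ℂ))
    (h02s : ∀ x ∈ U02, ∀ p q : Fin 5, x p q = x q p) (h12s : ∀ x ∈ U12, ∀ p q : Fin 5, x p q = x q p)
    (huU : u ∈ U02) (huU' : u ∈ U12) (haU : a ∉ U02)
    (hWs : ∀ μ ∈ W, ∀ s t : Fin 5, μ s t = μ t s) (hWd : ∀ μ ∈ W, ∀ s : Fin 5, μ s s = 0)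
    (hWc : ∀ μ ∈ W, contractZ μ ∈ L3 (Submodule.span ℂ ({u, a} : Set (Fin 5 → Fin 5 → ℂ))) U02 U12) :
    Module.finrank ℂ W ≤ 3 + Module.finrank ℂ (prolong (Submodule.span ℂ ({u, a} : Set (Fin 5 → Fin 5 → ℂ)) ⊔ U02))
      + Module.finrank ℂ (prolong U12) :=
  finrank_le_symDiag_add_prolong_add_plane u a hu ha U02 U12 W h02s h12s huU huU' haU 3
    (fun S hS => finrank_symDiag_le_three u hu hu0 S hS) hWs hWd hWc

/-- ★ **`finrank W ≤ finrank prolong(U₀₁ ⊔ U₀₂) + finrank prolong U₁₂`** when moreover `u` has a nonzero diagonal entry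
(✓ `symDiag_eq_bot_of_diag_ne_zero`). [folklore] -/
theorem finrank_le_prolong_add_plane_of_diag_ne_zero (u a : Fin 5 → Fin 5 → ℂ) (hu : ∀ p q, u p q = u q p)
    (ha : ∀ p q, a p q = a q p) (q : Fin 5) (hq : u q q ≠ 0) (U02 U12 W : Submodule ℂ (Fin 5 → Fin 5 → ℂ))
    (h02s : ∀ x ∈ U02, ∀ p q : Fin 5, x p q = x q p) (h12s : ∀ x ∈ U12, ∀ p q : Fin 5, x p q = x q p)
    (huU : u ∈ U02) (huU' : u ∈ U12) (haU : a ∉ U02)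
    (hWs : ∀ μ ∈ W, ∀ s t : Fin 5, μ s t = μ t s) (hWd : ∀ μ ∈ W, ∀ s : Fin 5, μ s s = 0)
    (hWc : ∀ μ ∈ W, contractZ μ ∈ L3 (Submodule.span ℂ ({u, a} : Set (Fin 5 → Fin 5 → ℂ))) U02 U12) :
    Module.finrank ℂ W ≤ Module.finrank ℂ (prolong (Submodule.span ℂ ({u, a} : Set (Fin 5 → Fin 5 → ℂ)) ⊔ U02))
      + Module.finrank ℂ (prolong U12) := by
  have h := finrank_le_symDiag_add_prolong_add_plane u a hu ha U02 U12 W h02s h12s huU huU' haU 0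
    (fun S hS => by rw [symDiag_eq_bot_of_diag_ne_zero u q hq S hS, finrank_bot]) hWs hWd hWc
  omega

end LaplaceFiveSeparatedCapture

end Summit.ValiantsHypothesis.ValiantsHypothesis.Theorems.RigidityForcesSymmetryRankRigidMinimalRepr
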